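import Summits.Ventures.Crystal3D.Kissing125.GSearchRelabel1
import HarnessLib

/-!
# Root normalisation and the conclusion from the parts, κ-generic — part 1/4

HONEST FRAMING (cell pub-crystal3d, K-path at `h = 5/4`, V4 = κ as an explicit parameter): this is NOT a result printed
by Hales; it is his METHOD (arXiv:1209.6043, Theorem 3 + Lemmas 7–10, in the tree's form of a verified interval-arithmetic
growth search, `Literature/…/KissingSearch*.lean`) with the largest long-side cosine `κ` made an EXPLICIT PARAMETER
(`κ : Kappa`, carrying the two numeric facts the soundness proof uses: `-1/2 ≤ κ`, `κ < 1/4`).  Only the declarations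
whose statement depends on `κ` are declared here (namespace `…Kissing125.GSearch`, the tree's short names, no renames);
every κ-free helper is the landed K25 copy (`…Kissing125.KissingSearch.*`) and every κ-free lemma is cited from the tree
(PRIVATE per-file citation aliases; `GSearchTransport.lean` holds `toT : St → tree St` and the transport equalities).  The K25
instance is `κ25 = ⟨7/32, …⟩`; `GSearchBridge.lean` identifies the generic checker at
`κ25` with the landed `Kissing125.KissingSearch.checkPart`, so the landed run files are consumed unchanged.  Generated by
`HOME/lean/kissing125/v4-prep/gen/mkgen.py`; nothing here is asserted about GAP(1.26) or any census.

THIS FILE: the κ-tainted declarations of `Literature/Geometry/DiscreteGeometry/KissingSearchRoot.lean` (part 1 of 4), with `κ : Kappa` threaded; κ-free declarations of that file are NOT re-declared publicly (the κ-free helpers are the landed K25 copies; the κ-free tree lemmas used by the proofs are cited through PRIVATE aliases at the top of the file).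

## References
* T. C. Hales, *A proof of Fejes Tóth's conjecture on sphere packings with kissing number twelve*,
  arXiv:1209.6043 (2012): Definition 1, Theorem 2, Theorem 3, Lemmas 7–10. [`Hales2012`]
* R. E. Moore, *Interval Analysis* (1966), Theorem 3.1, §4.4. [`Moore1966`]
-/

namespace Summit.Ventures.Crystal3D.Kissing125

open Literature.Geometry.DiscreteGeometry
open Summit.Ventures.Crystal3D.Kissing125.KissingSearch

namespace GSearch

open Real Literature.Analysis.ValidatedNumerics KissingLP NonemptyInterval Finset

variable {κ : Kappa}


/-! ### Part A. A vertex with four contacts and at most one long side -/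

section RootVertex

variable (M : KConf κ)

/-- `Σ_v #contacts(v) ≥ 46`. [cite: Hales2012, proof of Theorem 3] -/
theorem KConf.sum_card_contacts (M : KConf κ) : 46 ≤ ∑ v ∈ Finset.range 12, (M.contacts v).card := by
  classical
  -- ordered contact pairs
  set P := ((Finset.range 12) ×ˢ (Finset.range 12)).filter fun p => p.1 ≠ p.2 ∧ M.g p.1 p.2 = 1 / 2 with hP
  have hsum : ∑ v ∈ Finset.range 12, (M.contacts v).card = P.card := by
    rw [hP, Finset.card_filter, Finset.sum_product]
    refine Finset.sum_congr rfl fun v _ => ?_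
    unfold KConf.contacts
    rw [Finset.card_filter]
    refine Finset.sum_congr rfl fun u _ => ?_
    by_cases h : u ≠ v ∧ M.g v u = 1 / 2
    · rw [if_pos h, if_pos ⟨Ne.symm h.1, h.2⟩]
    · rw [if_neg h, if_neg (fun h' => h ⟨Ne.symm h'.1, h'.2⟩)]
  rw [hsum]
  -- two copies of the unordered contact pairs inject into `P`
  set C := ((Finset.range 12) ×ˢ (Finset.range 12)).filter fun p => p.1 < p.2 ∧ M.g p.1 p.2 = 1 / 2 with hC
  have h23 : 23 ≤ C.card := M.contacts_ge
  have hsub : C ∪ C.image Prod.swap ⊆ P := by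
    intro p hp
    rw [Finset.mem_union, Finset.mem_image] at hp
    rw [hP, Finset.mem_filter, Finset.mem_product, Finset.mem_range, Finset.mem_range]
    rcases hp with hp | ⟨q, hq, rfl⟩
    · rw [hC, Finset.mem_filter, Finset.mem_product, Finset.mem_range, Finset.mem_range] at hp
      exact ⟨hp.1, ne_of_lt hp.2.1, hp.2.2⟩
    · rw [hC, Finset.mem_filter, Finset.mem_product, Finset.mem_range, Finset.mem_range] at hq
      simp only [Prod.fst_swap, Prod.snd_swap]
      exact ⟨⟨hq.1.2, hq.1.1⟩, (ne_of_lt hq.2.1).symm, by rw [M.g_symm]; exact hq.2.2⟩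
  have hdisj : Disjoint C (C.image Prod.swap) := by
    rw [Finset.disjoint_left]
    intro p hp hp'
    rw [Finset.mem_image] at hp'
    obtain ⟨q, hq, rfl⟩ := hp'
    rw [hC, Finset.mem_filter] at hp hq
    simp only [Prod.fst_swap, Prod.snd_swap] at hp
    exact lt_asymm hp.2.1 hq.2.1
  have := Finset.card_le_card hsub
  rw [Finset.card_union_of_disjoint hdisj, Finset.card_image_of_injective _ Prod.swap_injective] at this
  omega

/-- `Σ_v #longSpokes(v) ≤ 14`. [cite: Hales2012, Lemma 7] -/
theorem KConf.sum_card_longSpokes (M : KConf κ) : ∑ v ∈ Finset.range 12, (M.longSpokes v).card ≤ 14 := by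
  classical
  -- ordered pairs `(v, u)` with `{v, u}` a long side
  have hsum : ∑ v ∈ Finset.range 12, (M.longSpokes v).card =
      (((Finset.range 12) ×ˢ (Finset.range 12)).filter fun p => ({p.1, p.2} : Finset ℕ) ∈ M.longSides).card := by
    rw [Finset.card_filter, Finset.sum_product]
    refine Finset.sum_congr rfl fun v _ => ?_
    unfold KConf.longSpokes
    rw [Finset.card_filter]
  rw [hsum]
  -- each long side has exactly two ordered pairs
  have hle : (((Finset.range 12) ×ˢ (Finset.range 12)).filter fun p => ({p.1, p.2} : Finset ℕ) ∈ M.longSides).card ≤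
      (M.longSides ×ˢ (Finset.range 2)).card := by
    refine Finset.card_le_card_of_injOn (fun p => (({p.1, p.2} : Finset ℕ), if p.1 < p.2 then 0 else 1)) ?_ ?_
    · intro p hp
      rw [Finset.mem_coe, Finset.mem_filter] at hp
      rw [Finset.mem_coe, Finset.mem_product, Finset.mem_range]
      refine ⟨hp.2, ?_⟩
      dsimp only
      split_ifs <;> norm_num
    · intro p hp p' hp' e
      rw [Finset.mem_coe, Finset.mem_filter, Finset.mem_product, Finset.mem_range, Finset.mem_range] at hp hp'
      simp only [Prod.mk.injEq] at e
      obtain ⟨e1, e2⟩ := e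
      -- long sides have two elements
      have hne : p.1 ≠ p.2 := by
        intro h
        have := hp.2
        unfold KConf.longSides at this
        rw [Finset.mem_filter, M.mem_sides, h] at this
        simp at this
      have hne' : p'.1 ≠ p'.2 := by
        intro h
        have := hp'.2
        unfold KConf.longSides at this
        rw [Finset.mem_filter, M.mem_sides, h] at this
        simp at this
      have m1 : p.1 ∈ ({p'.1, p'.2} : Finset ℕ) := by rw [← e1]; simp
      have m2 : p.2 ∈ ({p'.1, p'.2} : Finset ℕ) := by rw [← e1]; simp
      simp only [Finset.mem_insert, Finset.mem_singleton] at m1 m2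
      have hiff : (p.1 < p.2 ↔ p'.1 < p'.2) := by
        by_cases c1 : p.1 < p.2 <;> by_cases c2 : p'.1 < p'.2 <;> simp [c1, c2] at e2 ⊢
      apply Prod.ext <;> omega
  rw [Finset.card_product, Finset.card_range] at hle
  have := M.card_longSides_le
  omega

/-- **A root vertex**: four contacts and at most one long side. [cite: Hales2012, proof of Theorem 3] -/
theorem KConf.exists_root_vertex (M : KConf κ) : ∃ v, v < 12 ∧ (M.contacts v).card = 4 ∧ (M.longSpokes v).card ≤ 1 := by
  classical
  by_contra h
  push Not at h
  have hc4 : ∀ v, v < 12 → (M.contacts v).card ≤ 4 := fun v hv => M.cdeg_le v hv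
  -- every vertex contributes at most `4` to `contacts + (4 - ...)`: if contacts = 4 then spokes ≥ 2
  have key : ∀ v ∈ Finset.range 12, 2 * (M.contacts v).card ≤ 6 + (M.longSpokes v).card := by
    intro v hv
    rw [Finset.mem_range] at hv
    have h1 := hc4 v hv
    by_cases h4 : (M.contacts v).card = 4
    · have := h v hv h4; omega
    · omega
  have hs := Finset.sum_le_sum key
  rw [← Finset.mul_sum, Finset.sum_add_distrib, Finset.sum_const, Finset.card_range] at hs
  have h46 := M.sum_card_contacts
  have h14 := M.sum_card_longSpokes
  simp only [smul_eq_mul] at hs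
  omega

/-- The triangles of `M` at `v` as a `KConf`-level set. [folklore] -/
theorem KConf.mem_filter_at (M : KConf κ) {v : ℕ} {t : Finset ℕ} : t ∈ M.T.filter (fun t => v ∈ t) ↔ t ∈ M.T ∧ v ∈ t := Finset.mem_filter

/-- The other triangle on a side. [folklore] -/
theorem KConf.exists_other (M : KConf κ) {t : Finset ℕ} (ht : t ∈ M.T) {a b : ℕ} (ha : a ∈ t) (hb : b ∈ t) (hab : a ≠ b) :
    ∃ t' ∈ M.T, t' ≠ t ∧ a ∈ t' ∧ b ∈ t' := by
  classical
  have h2 := M.two t ht a ha b hb hab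
  have hmem : t ∈ M.T.filter (fun t' => a ∈ t' ∧ b ∈ t') := Finset.mem_filter.2 ⟨ht, ha, hb⟩
  obtain ⟨t', ht', hne⟩ := Finset.exists_mem_ne (by rw [h2]; norm_num) t
  rw [Finset.mem_filter] at ht'
  exact ⟨t', ht'.1, hne, ht'.2.1, ht'.2.2⟩

/-- The third vertex of a triangle through two given labels. [folklore] -/
theorem KConf.exists_third_of_mem (M : KConf κ) {t : Finset ℕ} (ht : t ∈ M.T) {a b : ℕ} (ha : a ∈ t) (hb : b ∈ t) (hab : a ≠ b) :
    ∃ c, c < 12 ∧ c ≠ a ∧ c ≠ b ∧ t = {a, b, c} := by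
  classical
  obtain ⟨hc3, hlt⟩ := M.mem_T t ht
  have hsub : ({a, b} : Finset ℕ) ⊆ t := by
    intro x hx; simp only [Finset.mem_insert, Finset.mem_singleton] at hx
    rcases hx with rfl | rfl
    · exact ha
    · exact hb
  have hcard : (t \ {a, b}).card = 1 := by rw [Finset.card_sdiff_of_subset hsub, hc3, Finset.card_pair hab]
  obtain ⟨c, hc⟩ := Finset.card_eq_one.1 hcard
  have hcm : c ∈ t \ {a, b} := by rw [hc]; simp
  rw [Finset.mem_sdiff] at hcm
  simp only [Finset.mem_insert, Finset.mem_singleton, not_or] at hcm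
  refine ⟨c, hlt c hcm.1, hcm.2.1, hcm.2.2, ?_⟩
  have : t = {a, b} ∪ (t \ {a, b}) := (Finset.union_sdiff_of_subset hsub).symm
  rw [this, hc]
  ext x; simp only [Finset.mem_union, Finset.mem_insert, Finset.mem_singleton]; tauto

end RootVertex

end GSearch

end Summit.Ventures.Crystal3D.Kissing125
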